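/-
Copyright (c) 2026 H21 harness contributors. Released under Apache 2.0 license.

REPRODUCTION / ANALYSIS OF A CLAIMED RESULT UNDER ADJUDICATION (withdrawn): Yilei Chen, "Quantum Algorithms
for Lattice Problems", IACR ePrint 2024/555, version of 2024-04-18 (bib key `ChenQuantumLattice2024`).
-/
import Literature.Computability.Cryptography.ChenQuantumLWEStepEight
import Literature.Computability.Cryptography.ChenQuantumLWEDisplayRefutation

/-!
# Chen (2024), Lemma 2.17 (domain extension): valid at Step 8, not at Step 9

REPRODUCTION / ANALYSIS OF A CLAIMED RESULT UNDER ADJUDICATION (withdrawn).  HONEST FRAMING: this module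
DECIDES the last two statements of `ChenQuantumLWESteps` that were typed as `Prop`s and left undecided —
`DomainExtReadsThrough` (the content of Lemma 2.17, p. 14) and `Shape.Step8Premise` (the author's p. 32
verification that the Step-7 amplitude `f₇` of eq. (37) is `M`-periodic, eq. (38)) — both TRUE, both a few
lines, and records the resulting contrast with Step 9 (`Shape.not_step9Display`,
`ChenQuantumLWEDisplayRefutation`).  The value is a THEOREM about a WITHDRAWN algorithm — NOT progress on
LWE, on any lattice problem or on quantum advantage; it repairs nothing and breaks nothing.  No definition is
introduced.  Bookkeeping consequence: every claim of the source typed as a `Prop` in the statement layer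
(`ChenQuantumLWESteps`, `ChenQuantumLWEProductState`) is now decided in the tree — `Shape.Claim314 |φ7.d⟩` ✓
(`Shape.claim314_phi7d`), `Shape.Step8Premise` ✓ and `DomainExtReadsThrough` ✓ (this module),
`CertificateGivesProduct` ✓, `LocalMapsPreserveProduct` ✓, `GaussSumModulus` ✓ (`ChenQuantumLWEProductProofs`),
`Shape.Step9Display` ✗ (`Shape.not_step9Display`), `Shape.Lemma38Certainty` ✗ for `|φ8.f⟩` and for every
isometric branch (`ChenQuantumLWELemma38`, `ChenQuantumLWEBornRule`).

* `domainExtReadsThrough_holds` — Lemma 2.17 as the paper states it (`n, P, C ∈ ℕ⁺`, `f` `P`-periodic): the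
  register operation `domainExt C` maps `Σ_{x ∈ ℤ_Pⁿ} f(x)|x⟩` to `Σ_{z ∈ ℤ_{CP}ⁿ} f(z)|z⟩`.
* `Shape.step8Premise_holds` — `f₇` IS `M`-periodic (it is defined through residues mod `M`), for every shape,
  admissible or not; `Shape.phi7_eq_ketOf` — `|φ7⟩ = Σ_{a} f₇(a)|a mod M⟩` (eq. (36)); hence
  `Shape.phi7a_eq_ketOf` — Step 8's operation (8.i) `ℤ_M → ℤ_{DM}` IS Lemma 2.17 applied within its
  hypotheses: `|φ7.a⟩ = Σ_{z ∈ ℤ_{DM}ⁿ⁺¹} f₇(z)|z⟩`.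
* `Shape.lemma217_at_step8_and_step9` — the contrast in one statement: at Step 8 the premise of Lemma 2.17
  holds and the extension reads through `f₇`; at Step 9 the displayed `|φ8.g⟩` (p. 37) is NOT what the same
  register operation does to `|φ8.f⟩` (`¬ Step9Display`; the author's note p. 37: "the amplitude of |φ8.f⟩
  does not satisfy M/2-periodicity").

[cite: ChenQuantumLattice2024, Def. 2.16 and Lemma 2.17 p. 14; eq. (36)–(38) and author's note p. 32;
§3.5.8 (8.i) p. 32; §3.5.9 display and author's note p. 37]
-/

namespace Literature.Computability.Cryptography.Chen2024

open scoped BigOperators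

/-- **Lemma 2.17 (domain extension) holds as stated:** for `P, C ≥ 1` and a `P`-periodic `f : ℤⁿ → ℂ`,
adjoining uniform high digits maps `Σ_{x ∈ ℤ_Pⁿ} f(x)|x⟩` to `Σ_{z ∈ ℤ_{CP}ⁿ} f(z)|z⟩` — the amplitude at
`z` is `f (z mod P) = f z` by periodicity.  (The operation `domainExt C` is defined for every input state;
this is the statement that it "reads through" a periodic amplitude function, which is how the paper uses it.)
[cite: ChenQuantumLattice2024, Def. 2.16 and Lemma 2.17 p. 14] -/
theorem domainExtReadsThrough_holds {n : ℕ} (P C : ℕ) [NeZero P] [NeZero C] (f : (Fin n → ℤ) → ℂ) :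
    DomainExtReadsThrough P C f := by
  intro hf
  haveI : NeZero (C * P) := ⟨mul_ne_zero (NeZero.ne C) (NeZero.ne P)⟩
  funext z
  simp only [domainExt, ketOf]
  apply hf
  intro i
  rw [Int.cast_natCast, Int.cast_natCast, ZMod.natCast_zmod_val, ZMod.castHom_apply, ZMod.cast_eq_val]

namespace Shape

variable (S : Shape)

/-- **The Step-8 premise holds** (author's note p. 32: "the domain extension trick applied here is
correct"): the amplitude function `f₇` of eq. (37) is `M`-periodic (eq. (38)) — for EVERY shape, since `f₇`
is defined through the residues of its argument mod `M`.
[cite: ChenQuantumLattice2024, eq. (37)–(38) and author's note p. 32] -/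
theorem step8Premise_holds : S.Step8Premise := by
  intro x y hxy
  have hfun : (fun i => ((x i : ℤ) : ZMod S.M)) = fun i => ((y i : ℤ) : ZMod S.M) := funext hxy
  show S.f7 x = S.f7 y
  simp only [f7, hfun]

/-- Eq. (36): `|φ7⟩ = Σ_{a ∈ ℤⁿ⁺¹} f₇(a)|a mod M⟩`, i.e. `|φ7⟩` is the state denoted by the `M`-periodic
`f₇` (one period of representatives). [cite: ChenQuantumLattice2024, eq. (35)–(37) pp. 31–32] -/
theorem phi7_eq_ketOf : S.phi7 = ketOf S.M S.f7 := by
  haveI : NeZero (S.M : ℕ) := ⟨S.M.ne_zero⟩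
  funext z
  have hz : (fun i => ((((z i).val : ℕ) : ℤ) : ZMod S.M)) = z := by
    funext i
    rw [Int.cast_natCast, ZMod.natCast_zmod_val]
  simp only [phi7, ketOf, f7, hz]

/-- **Step 8's (8.i) is Lemma 2.17 applied within its hypotheses:** the extended state
`|φ7.a⟩ = domainExt D |φ7⟩` on `ℤ_{DM}ⁿ⁺¹` IS `Σ_{z ∈ ℤ_{DM}ⁿ⁺¹} f₇(z)|z⟩`.
[cite: ChenQuantumLattice2024, §3.5.8 (8.i) and eq. (38) p. 32; Lemma 2.17 p. 14] -/
theorem phi7a_eq_ketOf : S.phi7a = ketOf ((S.D : ℕ) * S.M) S.f7 := by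
  haveI : NeZero (S.M : ℕ) := ⟨S.M.ne_zero⟩
  haveI : NeZero (S.D : ℕ) := ⟨S.D.ne_zero⟩
  rw [phi7a, phi7_eq_ketOf]
  exact domainExtReadsThrough_holds (S.M : ℕ) (S.D : ℕ) S.f7 S.step8Premise_holds

/-- **Lemma 2.17 at Step 8 and at Step 9, in one statement.**  For every admissible shape: (Step 8) the
premise of Lemma 2.17 holds — `f₇` is `M`-periodic — and the extension `ℤ_M → ℤ_{DM}` reads through `f₇`
(`|φ7.a⟩ = Σ_z f₇(z)|z⟩`); (Step 9) the displayed `|φ8.g⟩` of p. 37 is NOT the result of the same register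
operation (first coordinate, `ℤ_{M/(2Q)}`-digits adjoined up to `ℤ_{M/2}`) applied to `|φ8.f⟩` — the
author's withdrawal note: "the amplitude of |φ8.f⟩ does not satisfy M/2-periodicity … the expression of
|φ8.g⟩ is wrong".  [cite: ChenQuantumLattice2024, eq. (38) and note p. 32; §3.5.9 display and note p. 37] -/
theorem lemma217_at_step8_and_step9 (h : S.Admissible) :
    (S.Step8Premise ∧ S.phi7a = ketOf ((S.D : ℕ) * S.M) S.f7) ∧ ¬ S.Step9Display :=
  ⟨⟨S.step8Premise_holds, S.phi7a_eq_ketOf⟩, S.not_step9Display h⟩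

end Shape

end Literature.Computability.Cryptography.Chen2024
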